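import Summits.HubbardSuperconductivity.HubbardSuperconductivity.Theorems.AnisotropyChordInsertionEntropyInfrared

/-!
# Route `AnisotropyChord` / H0 rotor rung: the entropy route — the RESIDUE form (`BC² = (1−ρ_M)·Z_x`,
# residue floor), the second-moment form H1⁺ ⇒ H1, and the weakest head crux E_Z with its proved links
# `E ⇒ E_Z ⇒ eventual condensation` (theory seat memo ROTOR-THEORY-7 §96–§97; Sketch7 Parts G–I
# transplanted verbatim up to namespace and docstring tags)

* `insertionResidue` (`Z_x`), `insertionResidue_le_one` (Cauchy–Schwarz), `bhatt_sq_eq_residue`,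
  **RESIDUE FLOOR** `condensateDensity_ge_of_residue` (entropy-free E-FLOOR);
* `sum_mul_le_sqrt_sum_mul_sq`, `sub_sum_mul_le_of_sq` (H1⁺ ⇒ H1), typed `OneBodyInsertionStructureSq`;
* crux **E_Z** `InsertionResidueBound` (typed, OPEN; «no insertion orthogonality catastrophe») with the
  PROVED links `eventualCondensate_of_residueBound` and `residueBound_of_insertionEntropyBound` (E ⇒ E_Z).

Typing authority: theory seat `hubbard-h0-rotor-theory-1`, cycle 7.  Nothing here claims E_Z.
-/

set_option linter.dupNamespace false

noncomputable section

open Matrix Finset Real Filter Topology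
open Literature.MathematicalPhysics.QuantumLattice Literature.Probability.LatticeModels

namespace Summit.HubbardSuperconductivity.HubbardSuperconductivity.Theorems.AnisotropyChord.InsertionEntropy

/-! ## G. The residue form -/

section Residue

variable {V : Type} [Fintype V] [DecidableEq V]

/-- Local insertion (quasiparticle) residue `Z_x`. (theory seat `hubbard-h0-rotor-theory-1`, memo ROTOR-THEORY-7) [folklore] -/
def insertionResidue (aM aN : (V → Fin 2) → ℝ) (x : V) : ℝ :=
  siteTower aM aN x ^ 2 / ((1 - siteDensity aM x) * siteDensity aN x)

/-- `m_x ≥ 0` for non-negative amplitudes. (theory seat `hubbard-h0-rotor-theory-1`, memo ROTOR-THEORY-7) [folklore] -/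
theorem siteTower_nonneg (aM aN : (V → Fin 2) → ℝ) (x : V) (hM : ∀ τ, 0 ≤ aM τ)
    (hN : ∀ σ, 0 ≤ aN σ) : 0 ≤ siteTower aM aN x := by
  unfold siteTower
  exact Finset.sum_nonneg fun τ _ => by split_ifs <;> [exact mul_nonneg (hM τ) (hN _); exact le_rfl]

/-- Vacancy mass: `Σ_{τ : x empty} ψ_M(τ)² = 1 − ρ_{M,x}` for a normalised state. (theory seat `hubbard-h0-rotor-theory-1`, memo ROTOR-THEORY-7) [folklore] -/
theorem sum_vacant_sq (aM : (V → Fin 2) → ℝ) (x : V) (hM1 : ∑ τ, aM τ ^ 2 = 1) :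
    (∑ τ, if τ x = 1 then aM τ ^ 2 else 0) = 1 - siteDensity aM x := by
  unfold siteDensity
  have h : ∀ τ : V → Fin 2, (if τ x = 1 then aM τ ^ 2 else 0) + (if τ x = 0 then aM τ ^ 2 else 0)
      = aM τ ^ 2 := by
    intro τ
    rcases Fin.exists_fin_two.mp ⟨τ x, rfl⟩ with h0 | h1
    · simp [h0]
    · simp [h1]
  have := Finset.sum_congr rfl fun τ (_ : τ ∈ (univ : Finset (V → Fin 2))) => h τ
  rw [Finset.sum_add_distrib, hM1] at this
  linarith

/-- **`Z_x ≤ 1`** (Cauchy–Schwarz): the residue is a squared cosine. (theory seat `hubbard-h0-rotor-theory-1`, memo ROTOR-THEORY-7) [folklore] -/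
theorem insertionResidue_le_one (aM aN : (V → Fin 2) → ℝ) (x : V) (hM1 : ∑ τ, aM τ ^ 2 = 1)
    (hq : siteDensity aM x < 1) (hρ : 0 < siteDensity aN x) :
    insertionResidue aM aN x ≤ 1 := by
  unfold insertionResidue
  rw [div_le_one (mul_pos (by linarith) hρ), ← sum_vacant_sq aM x hM1]
  unfold siteTower siteDensity
  -- m_x = Σ_τ u τ * v τ with u τ = [τ x = 1] aM τ, v τ = [τ x = 1] aN(τ + x)
  have hcs := Finset.sum_mul_sq_le_sq_mul_sq (univ : Finset (V → Fin 2))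
    (fun τ => if τ x = 1 then aM τ else 0) (fun τ => if τ x = 1 then aN (Function.update τ x 0) else 0)
  have h1 : (∑ τ, (if τ x = 1 then aM τ else 0) * (if τ x = 1 then aN (Function.update τ x 0) else 0))
      = ∑ τ, (if τ x = 1 then aM τ * aN (Function.update τ x 0) else 0) :=
    Finset.sum_congr rfl fun τ _ => by split_ifs <;> simp
  have h2 : (∑ τ, (if τ x = 1 then aM τ else 0) ^ 2) = ∑ τ, (if τ x = 1 then aM τ ^ 2 else 0) :=
    Finset.sum_congr rfl fun τ _ => by split_ifs <;> simp
  -- Σ_{τ x = 1} aN(τ+x)² = Σ_{σ x = 0} aN σ²  (bijection τ ↦ τ + x)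
  have h3 : (∑ τ, (if τ x = 1 then aN (Function.update τ x 0) else 0) ^ 2)
      = ∑ σ : V → Fin 2, (if σ x = 0 then aN σ ^ 2 else 0) := by
    have hsq : (∑ τ, (if τ x = 1 then aN (Function.update τ x 0) else 0) ^ 2)
        = ∑ τ : V → Fin 2, (if τ x = 1 then aN (Function.update τ x 0) ^ 2 else 0) :=
      Finset.sum_congr rfl fun τ _ => by split_ifs <;> simp
    rw [hsq]
    -- reindex along the involution-free bijection `Function.update · x 0` on {τ x = 1} → {σ x = 0}
    rw [← Finset.sum_filter, ← Finset.sum_filter]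
    refine Finset.sum_nbij' (fun τ => Function.update τ x 0) (fun σ => Function.update σ x 1) ?_ ?_ ?_ ?_ ?_
    · intro τ hτ; simp
    · intro σ hσ; simp
    · intro τ hτ
      simp only [Finset.mem_filter, Finset.mem_univ, true_and] at hτ
      ext y; by_cases hy : y = x
      · subst hy; simp [hτ]
      · simp [Function.update_of_ne hy]
    · intro σ hσ
      simp only [Finset.mem_filter, Finset.mem_univ, true_and] at hσ
      ext y; by_cases hy : y = x
      · subst hy; simp [hσ]
      · simp [Function.update_of_ne hy]
    · intro τ _; rfl
  rw [h1, h2, h3] at hcs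
  exact hcs

/-- **`BC(ν_x, π_M)² = (1 − ρ_{M,x}) · Z_x`** — the Bhattacharyya coefficient of the entropy route IS the
insertion residue (memo §96(b)). (theory seat `hubbard-h0-rotor-theory-1`, memo ROTOR-THEORY-7) [folklore] -/
theorem bhatt_sq_eq_residue (aM aN : (V → Fin 2) → ℝ) (x : V) (hM : ∀ τ, 0 ≤ aM τ) (hN : ∀ σ, 0 ≤ aN σ)
    (hρ : 0 < siteDensity aN x) (hq : siteDensity aM x < 1) :
    bhatt (holeLaw aN x) (bornLaw aM) ^ 2 = (1 - siteDensity aM x) * insertionResidue aM aN x := by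
  have hT := siteTower_eq aM aN x hM hN hρ
  have hq' : 1 - siteDensity aM x ≠ 0 := ne_of_gt (by linarith)
  have hρ' : siteDensity aN x ≠ 0 := ne_of_gt hρ
  unfold insertionResidue
  rw [hT, mul_pow, Real.sq_sqrt hρ.le]
  field_simp

/-- **RESIDUE FLOOR.** `n₀/|V| ≥ ρ (1 − ρ_M) · z` whenever every local insertion residue is `≥ z`
(uniform densities `ρ` of `ψ_N` and `ρ_M` of `ψ_{N−1}`). Entropy-free form of E-FLOOR. (theory seat `hubbard-h0-rotor-theory-1`, memo ROTOR-THEORY-7) [folklore] -/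
theorem condensateDensity_ge_of_residue [Nonempty V] (aM aN : (V → Fin 2) → ℝ) (ρ ρM z : ℝ)
    (hρ : 0 < ρ) (hρM : ρM < 1) (hz : 0 ≤ z) (hM : ∀ τ, 0 ≤ aM τ) (hN : ∀ σ, 0 ≤ aN σ)
    (hM1 : ∑ τ, aM τ ^ 2 = 1) (hdens : ∀ x, siteDensity aN x = ρ) (hdensM : ∀ x, siteDensity aM x = ρM)
    (hZ : ∀ x, z ≤ insertionResidue aM aN x) :
    ρ * (1 - ρM) * z ≤ condensateDensity aN := by
  -- per-site: m_x² = Z_x (1−ρM) ρ ≥ z (1−ρM) ρ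
  have hm2 : ∀ x, ρ * (1 - ρM) * z ≤ siteTower aM aN x ^ 2 := by
    intro x
    have hx := hZ x
    unfold insertionResidue at hx
    rw [hdens x, hdensM x, le_div_iff₀ (mul_pos (by linarith) hρ)] at hx
    linarith
  have hm : ∀ x, Real.sqrt (ρ * (1 - ρM) * z) ≤ siteTower aM aN x := fun x =>
    (Real.sqrt_le_sqrt (hm2 x)).trans_eq (Real.sqrt_sq (siteTower_nonneg aM aN x hM hN))
  have hsum : (Fintype.card V : ℝ) * Real.sqrt (ρ * (1 - ρM) * z) ≤ towerSum aM aN := by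
    rw [towerSum_eq_sum_siteTower]
    have := Finset.card_nsmul_le_sum (univ : Finset V) (fun x => siteTower aM aN x)
      (Real.sqrt (ρ * (1 - ρM) * z)) (fun x _ => hm x)
    simpa [nsmul_eq_mul] using this
  have hpos : 0 ≤ (Fintype.card V : ℝ) * Real.sqrt (ρ * (1 - ρM) * z) := by positivity
  have hsq : ((Fintype.card V : ℝ) * Real.sqrt (ρ * (1 - ρM) * z)) ^ 2 ≤ lowerNormSq aN := by
    calc ((Fintype.card V : ℝ) * Real.sqrt (ρ * (1 - ρM) * z)) ^ 2 ≤ towerSum aM aN ^ 2 :=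
          pow_le_pow_left₀ hpos hsum 2
      _ ≤ (∑ τ, aM τ ^ 2) * lowerNormSq aN := towerSum_sq_le aM aN
      _ = lowerNormSq aN := by rw [hM1, one_mul]
  have hnn : 0 ≤ ρ * (1 - ρM) * z := by
    have : 0 ≤ ρ * (1 - ρM) := mul_nonneg hρ.le (by linarith)
    exact mul_nonneg this hz
  unfold condensateDensity
  rw [le_div_iff₀ (by positivity)]
  calc ρ * (1 - ρM) * z * (Fintype.card V : ℝ) ^ 2
        = ((Fintype.card V : ℝ) * Real.sqrt (ρ * (1 - ρM) * z)) ^ 2 := by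
          rw [mul_pow, Real.sq_sqrt hnn]; ring
    _ ≤ lowerNormSq aN := hsq

end Residue

/-! ## H. H1⁺: the second-moment form of the one-body structure, and H1⁺ ⇒ H1 -/

section OneBodySq

variable {ι : Type*} [Fintype ι]

/-- Cauchy–Schwarz for a mean against a probability law: `Σ p R ≤ √(Σ p R²)` (`p ≥ 0`, `Σ p = 1`). (theory seat `hubbard-h0-rotor-theory-1`, memo ROTOR-THEORY-7) [folklore] -/
theorem sum_mul_le_sqrt_sum_mul_sq (p R : ι → ℝ) (hp : ∀ i, 0 ≤ p i) (hp1 : ∑ i, p i = 1) :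
    ∑ i, p i * R i ≤ Real.sqrt (∑ i, p i * R i ^ 2) := by
  have hcs := Finset.sum_mul_sq_le_sq_mul_sq (univ : Finset ι)
    (fun i => Real.sqrt (p i)) (fun i => Real.sqrt (p i) * R i)
  have h1 : (∑ i, Real.sqrt (p i) * (Real.sqrt (p i) * R i)) = ∑ i, p i * R i :=
    Finset.sum_congr rfl fun i _ => by
      rw [← mul_assoc, ← Real.sqrt_mul (hp i), Real.sqrt_mul_self (hp i)]
  have h2 : (∑ i, Real.sqrt (p i) ^ 2) = 1 := by
    rw [← hp1]; exact Finset.sum_congr rfl fun i _ => Real.sq_sqrt (hp i)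
  have h3 : (∑ i, (Real.sqrt (p i) * R i) ^ 2) = ∑ i, p i * R i ^ 2 :=
    Finset.sum_congr rfl fun i _ => by rw [mul_pow, Real.sq_sqrt (hp i)]
  rw [h1, h2, h3, one_mul] at hcs
  have hnn : 0 ≤ ∑ i, p i * R i ^ 2 := Finset.sum_nonneg fun i _ => mul_nonneg (hp i) (sq_nonneg _)
  calc ∑ i, p i * R i ≤ |∑ i, p i * R i| := le_abs_self _
    _ = Real.sqrt ((∑ i, p i * R i) ^ 2) := (Real.sqrt_sq_eq_abs _).symm
    _ ≤ Real.sqrt (∑ i, p i * R i ^ 2) := Real.sqrt_le_sqrt hcs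

/-- **H1⁺ ⇒ H1 (the J-pairing of the remainder is controlled by its second moments):**
`Σ (p − q) R ≤ √(Σ p R²) + √(Σ q R²)`. (theory seat `hubbard-h0-rotor-theory-1`, memo ROTOR-THEORY-7) [folklore] -/
theorem sub_sum_mul_le_of_sq (p q R : ι → ℝ) (hp : ∀ i, 0 ≤ p i) (hq : ∀ i, 0 ≤ q i)
    (hp1 : ∑ i, p i = 1) (hq1 : ∑ i, q i = 1) :
    ∑ i, (p i - q i) * R i ≤ Real.sqrt (∑ i, p i * R i ^ 2) + Real.sqrt (∑ i, q i * R i ^ 2) := by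
  have hP := sum_mul_le_sqrt_sum_mul_sq p R hp hp1
  have hQ := sum_mul_le_sqrt_sum_mul_sq q (fun i => -R i) hq hq1
  have hQ' : -(∑ i, q i * R i) ≤ Real.sqrt (∑ i, q i * R i ^ 2) := by
    have e1 : (∑ i, q i * -R i) = -(∑ i, q i * R i) := by
      rw [← Finset.sum_neg_distrib]; exact Finset.sum_congr rfl fun i _ => by ring
    have e2 : (∑ i, q i * (-R i) ^ 2) = ∑ i, q i * R i ^ 2 :=
      Finset.sum_congr rfl fun i _ => by ring
    rw [e1, e2] at hQ; exact hQ
  have e : (∑ i, (p i - q i) * R i) = (∑ i, p i * R i) - ∑ i, q i * R i := by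
    rw [← Finset.sum_sub_distrib]; exact Finset.sum_congr rfl fun i _ => by ring
  rw [e]; linarith

end OneBodySq

section OneBodySqTorus

/-- **HYPOTHESIS H1⁺ — `OneBodyInsertionStructureSq`** (falsifiable form of H1): as H1, but the
remainder has second moment `≤ r` under BOTH the insertion law `ν_x` and the vacancy law `π̃_x`.
Not implied by `InsertionJBound`; ED residual variances ≤ 10⁻³·Var F (memo §87a). [conjecture: theory seat hubbard-h0-rotor-theory-1, cycle 7, 2026-08-28 — memo ROTOR-THEORY-7 §87a/§91 hypothesis H1⁺ (falsifiable second-moment form)] -/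
def OneBodyInsertionStructureSq (Δ : ℝ) (M : ℕ → ℝ) : Prop :=
  ∃ r C₁ : ℝ, ∀ᶠ L : ℕ in atTop, ∀ [NeZero L],
    ∀ aN aM : TensorIndex (TorusSite 2 L) 2 → ℝ,
      IsPerronSectorGroundAmplitude L Δ (M L) aN → IsPerronSectorGroundAmplitude L Δ (M L - 1) aM →
        ∀ x : TorusSite 2 L,
          (∀ τ, 0 < holeLaw aN x τ ↔ 0 < vacantLaw aM x τ) ∧
          ∃ (U : TorusSite 2 L → ℝ) (c : ℝ) (R : TensorIndex (TorusSite 2 L) 2 → ℝ),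
            (∀ τ, 0 < vacantLaw aM x τ →
              Real.log (holeLaw aN x τ / vacantLaw aM x τ) = c + linStat U τ + R τ) ∧
            (∑ τ, holeLaw aN x τ * R τ ^ 2 ≤ r) ∧ (∑ τ, vacantLaw aM x τ * R τ ^ 2 ≤ r) ∧
            (∀ k : TorusSite 2 L, k ≠ 0 →
              ‖kernelFT L U k‖ * structureFactor L aM ((L : ℝ) ^ 2 / 2 + (M L - 1)) k
                  * ((L : ℝ) ^ 2 / 2 + (M L - 1)) ≤ C₁ * (L : ℝ) ^ 2)

end OneBodySqTorus

/-! ## I. The weakest head: crux E_Z (uniform insertion residue) and its link to condensation -/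

section CruxZ

/-- **CONJECTURE E_Z — `InsertionResidueBound` (weakest head of the entropy route; OPEN).**  There is
`z > 0` such that, eventually in `L`, every Perron pair and every site have insertion residue
`Z_x ≥ z`: particle insertion at a site is NOT an orthogonality catastrophe. [conjecture: theory seat hubbard-h0-rotor-theory-1, cycle 7, 2026-08-28 — memo ROTOR-THEORY-7 §96–§97 crux E_Z (weakest head; OPEN)] -/
def InsertionResidueBound (Δ : ℝ) (M : ℕ → ℝ) : Prop :=
  ∃ z > (0 : ℝ), ∀ᶠ L : ℕ in atTop, ∀ [NeZero L],
    ∀ aN aM : TensorIndex (TorusSite 2 L) 2 → ℝ,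
      IsPerronSectorGroundAmplitude L Δ (M L) aN → IsPerronSectorGroundAmplitude L Δ (M L - 1) aM →
        ∀ x : TorusSite 2 L, z ≤ insertionResidue aM aN x

/-- **LINK (PROVED): `E_Z ⇒` eventual condensation**, floor `(ρ/2)(1 − ρ') z`, along a sequence of
density `ρ_L → ρ ∈ (0,1)` with reference density eventually `≤ ρ' < 1`. (theory seat `hubbard-h0-rotor-theory-1`, memo ROTOR-THEORY-7) [folklore] -/
theorem eventualCondensate_of_residueBound (Δ : ℝ) (M : ℕ → ℝ) (ρ ρ' : ℝ)
    (hρ : ρ ∈ Set.Ioo (0 : ℝ) 1) (hρ' : ρ' < 1)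
    (hlim : Tendsto (fun L : ℕ => 1 / 2 + M L / (L : ℝ) ^ 2) atTop (𝓝 ρ))
    (hle : ∀ᶠ L : ℕ in atTop, 1 / 2 + (M L - 1) / (L : ℝ) ^ 2 ≤ ρ')
    (hZ : InsertionResidueBound Δ M) (hU : UniformSiteDensity Δ M)
    (hU' : UniformSiteDensity Δ (fun L => M L - 1)) (hP : PerronSectorExists Δ M) :
    EventualCondensate Δ M := by
  obtain ⟨z, hz, hzL⟩ := hZ
  have hρ0 : 0 < ρ := hρ.1
  have hhalf : ∀ᶠ L : ℕ in atTop, ρ / 2 ≤ 1 / 2 + M L / (L : ℝ) ^ 2 :=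
    (hlim.eventually (eventually_ge_nhds (by linarith : ρ / 2 < ρ)))
  refine ⟨ρ / 2 * (1 - ρ') * z, by
    have : (0:ℝ) < 1 - ρ' := by linarith
    positivity, ?_⟩
  filter_upwards [hzL, hU, hU', hP, hhalf, hle] with L hzl hUL hUL' hPL hhL hleL
  intro _ aN haN
  obtain ⟨aM, haM⟩ := hPL
  set ρL := 1 / 2 + M L / (L : ℝ) ^ 2 with hρLdef
  set ρM := 1 / 2 + (M L - 1) / (L : ℝ) ^ 2 with hρMdef
  have hdpos : 0 < ρL := lt_of_lt_of_le (by positivity) hhL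
  have hρM1 : ρM < 1 := lt_of_le_of_lt hleL hρ'
  have main := condensateDensity_ge_of_residue aM aN ρL ρM z hdpos hρM1 hz.le
    haM.nonneg haN.nonneg haM.unit (hUL aN haN) (hUL' aM haM) (fun x => hzl aN aM haN haM x)
  have hmono : ρ / 2 * (1 - ρ') * z ≤ ρL * (1 - ρM) * z := by
    have h1 : ρ / 2 * (1 - ρ') ≤ ρL * (1 - ρM) :=
      mul_le_mul hhL (by linarith) (by linarith) hdpos.le
    exact mul_le_mul_of_nonneg_right h1 hz.le
  exact le_trans hmono main

/-- **E ⇒ E_Z (PROVED): an insertion-entropy bound gives a residue bound `z = e^{−K}`** (via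
`BC ≥ e^{−KL/2}` and `BC² = (1−ρ_M) Z ≤ Z`). (theory seat `hubbard-h0-rotor-theory-1`, memo ROTOR-THEORY-7) [folklore] -/
theorem residueBound_of_insertionEntropyBound (Δ : ℝ) (M : ℕ → ℝ) (ρ' : ℝ) (hρ' : ρ' < 1)
    (hE : InsertionEntropyBound Δ M) (hU : UniformSiteDensity Δ M)
    (hU' : UniformSiteDensity Δ (fun L => M L - 1))
    (hpos : ∀ᶠ L : ℕ in atTop, 0 < 1 / 2 + M L / (L : ℝ) ^ 2)
    (hle : ∀ᶠ L : ℕ in atTop, 1 / 2 + (M L - 1) / (L : ℝ) ^ 2 ≤ ρ') :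
    InsertionResidueBound Δ M := by
  obtain ⟨K, hK⟩ := hE
  refine ⟨Real.exp (-K), Real.exp_pos _, ?_⟩
  filter_upwards [hK, hU, hU', hpos, hle] with L hKL hUL hUL' hposL hleL
  intro _ aN aM haN haM x
  have hρx : 0 < siteDensity aN x := by rw [hUL aN haN x]; exact hposL
  have hqx : siteDensity aM x < 1 := by
    rw [hUL' aM haM x]; exact lt_of_le_of_lt hleL hρ'
  obtain ⟨hac, hKx⟩ := hKL aN aM haN haM x
  have hJ := bhatt_ge_exp_neg_half_klDiv (holeLaw aN x) (bornLaw aM) (holeLaw_nonneg aN x hρx)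
    (sum_holeLaw aN x hρx) hac
  -- e^{-K} ≤ e^{-KL} ≤ BC² = (1 - ρ_M) Z ≤ Z
  have hBC2 : Real.exp (-K) ≤ bhatt (holeLaw aN x) (bornLaw aM) ^ 2 := by
    have h1 : Real.exp (-K) ≤ Real.exp (-(klDiv (holeLaw aN x) (bornLaw aM)) / 2) ^ 2 := by
      rw [← Real.exp_nat_mul]; push_cast
      exact Real.exp_le_exp.mpr (by linarith)
    exact le_trans h1 (pow_le_pow_left₀ (le_of_lt (Real.exp_pos _)) hJ 2)
  rw [bhatt_sq_eq_residue aM aN x haM.nonneg haN.nonneg hρx hqx] at hBC2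
  have hZnn : 0 ≤ insertionResidue aM aN x := by
    unfold insertionResidue
    exact div_nonneg (sq_nonneg _) (mul_nonneg (by linarith) hρx.le)
  have hq1 : (1 - siteDensity aM x) ≤ 1 := by
    have : 0 ≤ siteDensity aM x := by
      unfold siteDensity; exact Finset.sum_nonneg fun σ _ => by split_ifs <;> positivity
    linarith
  calc Real.exp (-K) ≤ (1 - siteDensity aM x) * insertionResidue aM aN x := hBC2
    _ ≤ 1 * insertionResidue aM aN x := mul_le_mul_of_nonneg_right hq1 hZnn
    _ = insertionResidue aM aN x := one_mul _

end CruxZ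

end Summit.HubbardSuperconductivity.HubbardSuperconductivity.Theorems.AnisotropyChord.InsertionEntropy
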